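import Summits.CriticalPhenomena.PercolationContinuityZ3.Theses.PercHyperscalingGluing
import Literature.Probability.Percolation.SharpnessDCTProofs

/-!
# Route PercHyperscalingGluing — `Assembly` (item stmt-CriticalPhenomena-4648)

The assembly of route `PercHyperscalingGluing` (sub-problem `PercolationContinuityZ3`):
`BoxGluing → FreeBoxShattering → PercolationContinuityZ3`.

Proof (pure bookkeeping). The route file carries the gate-checked deciding theorem
`closes : BoxGluing → FreeBoxShattering → ThetaLeOneArm → PercolationContinuityZ3`
(`θ² ≤ π_n² ≤ C·K³·F_{Kn} → 0`). Its only non-crux hypothesis `ThetaLeOneArm`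
(`θ(p) ≤ P_p(0 ↔ ∂Λ_n)` for bond percolation on `ℤ^d`, Grimmett 1999 §1.4) is the tree theorem
`Literature.Probability.Percolation.DCT16.theta_le_real_siteToBoundary`
(`Literature/Probability/Percolation/SharpnessDCTProofs.lean`), which is not in the route file's
import closure; we import it here, discharge `ThetaLeOneArm`, and compose.
-/

namespace Summit.CriticalPhenomena.PercolationContinuityZ3.Theorems

/-- The known fact `ThetaLeOneArm` of route PercHyperscalingGluing: for bond percolation on `ℤ^d`,
every `d`, `p ∈ [0,1]` and `n`, `θ(p) = P_p(|C(0)| = ∞) ≤ P_p(0 ↔ ∂Λ_n inside Λ_n)` (an infinite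
open cluster of the origin leaves `Λ_n` through `∂Λ_n`; Grimmett 1999 §1.4). Discharged by the tree
theorem `Literature.Probability.Percolation.DCT16.theta_le_real_siteToBoundary`. [folklore] -/
theorem percHyperscalingGluing_thetaLeOneArm_proof :
    Summit.CriticalPhenomena.PercolationContinuityZ3.Theses.PercHyperscalingGluing.ThetaLeOneArm := by
  unfold Summit.CriticalPhenomena.PercolationContinuityZ3.Theses.PercHyperscalingGluing.ThetaLeOneArm
  intro d p n
  exact Literature.Probability.Percolation.DCT16.theta_le_real_siteToBoundary p n

/-- **Assembly of route PercHyperscalingGluing** (settles `stmt-CriticalPhenomena-4648`, exact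
signature): `BoxGluing → FreeBoxShattering → PercolationContinuityZ3`. With `π_n = P_{p_c}(0 ↔ ∂Λ_n)`
and `F_r = |Λ_r|⁻¹ Σ_{x∈Λ_r} P_{p_c}(0 ↔ x inside Λ_r)`: for `n ≥ 1`,
`θ(p_c)² ≤ π_n²` (`ThetaLeOneArm`) `≤ C·|Λ_n|⁻¹·Σ_{x∈Λ_n} P_{p_c}(0 ↔ x inside Λ_{Kn})` (`BoxGluing`)
`≤ C·K³·F_{Kn} → 0` (`FreeBoxShattering` along `r = Kn`), so `θ(p_c) = 0`. Obtained from the route's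
deciding theorem `PercHyperscalingGluing.closes` by discharging `ThetaLeOneArm` with
`percHyperscalingGluing_thetaLeOneArm_proof`. [folklore] -/
theorem percHyperscalingGluing_assembly_proof :
    Summit.CriticalPhenomena.PercolationContinuityZ3.Theses.PercHyperscalingGluing.Assembly := by
  unfold Summit.CriticalPhenomena.PercolationContinuityZ3.Theses.PercHyperscalingGluing.Assembly
  intro hB hF
  exact Summit.CriticalPhenomena.PercolationContinuityZ3.Theses.PercHyperscalingGluing.closes hB hF
    percHyperscalingGluing_thetaLeOneArm_proof

end Summit.CriticalPhenomena.PercolationContinuityZ3.Theorems
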